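import Literature.NumberTheory.LFunctions.RieszMeanInvDedekindZeta
import Literature.Analysis.Complex.VerticalLineShift
import Literature.Analysis.SpecialFunctions.InvSqAddSqIntegral
import HarnessLib

/-!
# Zhang (2022), Lemma 8.4 — IV: the contour bookkeeping (Perron at `Re u = κ`, shift to `Re u = σ₀`,
# truncation at height `T`, the rectangle `[−σ₁, σ₀] × [−T, T]`, and the bounds for the pieces)

Topic `Literature/NumberTheory/LFunctions/Zhang2022` (Landau–Siegel audit tree; verdict-neutral).
Y. Zhang, *Discrete mean estimates and the Landau–Siegel zero*, arXiv:2211.02515v1 (2022)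
[Zhang2022LandauSiegel] — **an unrefereed manuscript under adjudication**; DAG nodes `Z22:Lem8.4.pf`,
`Z22:(8.9)` [Z22 p.46–47, tex L2399–2418]: "The sum is equal to `(2πi)⁻¹∫_{(1)} … x^s ds/(s+β_μ)²`
(8.9). The contour of integration is moved in the same way as in the proof of Lemma 8.2" — i.e. to the
segments `Re s = α` (`|t| ≥ D`), `Re s = −𝓛⁻¹` (`|t| ≤ D`) and the two connecting horizontal segments.

This file is the generic (character-free) bookkeeping for an integrand `G(u) = e^{uL}Φ(u)/u²` on
vertical lines `u = σ + it`, with every constant explicit (Landau's method as in the tree's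
`PerronShift`, `RieszMeanInvDedekindZeta.lean`, but WITHOUT the holomorphy of `Φ` inside the
rectangle — the poles are handled by the consumer through the tree's residue theorem
`Literature.Analysis.Complex.rectBoundaryIntegral_eq_sum_of_poles`):

* `integrable_line`, `norm_G_line_le` — `‖G(σ+it)‖ ≤ e^{σL}M/(σ²+t²)` and integrability on `Re u = σ > 0`
  when `‖Φ‖ ≤ M` there;
* `sum_log_eq_integral_shift` — Perron (the tree's `LogRieszMean.sum_mul_log_eq_integral_LSeries`)
  at `Re u = κ` followed by the pole-free shift to `Re u = σ₀ ∈ (0, κ]`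
  (`Literature.Analysis.Complex.integral_vertical_eq_of_differentiableOn`):
  `∑_{n≤x} f(n)log(x/n) = (1/2π)∫ G(σ₀+it) dt` when `L(f,·) = Φ` on `Re u = κ`;
* `integral_line_decomp` — `∫_ℝ G(σ₀+it)dt = tails + ∫_{−T}^{T} G(−σ₁+it)dt + i(bottom − top) − i∮_{∂R} G`
  for the rectangle `R = [−σ₁, σ₀] × [−T, T]` (pure measure theory: the line splits at `±T`);
* `norm_tails_le`, `norm_horizontal_le`, `norm_left_le` — the bounds for the pieces from pointwise
  bounds on `Φ`.

Nothing about the manuscript's Theorems 1–2 or about Landau–Siegel zeros is asserted.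

## References

* Y. Zhang, arXiv:2211.02515v1 (2022), §8 Lemma 8.4 (proof), (8.9). [cite: Zhang2022LandauSiegel, §8 (8.9)]
* H. L. Montgomery, R. C. Vaughan, *Multiplicative Number Theory I*, CUP 2007, §5.1 (5.21)–(5.22)
  (Perron for Riesz means), §6.2 (Landau's contour). [cite: MontgomeryVaughan2007, §5.1 and §6.2]
-/

noncomputable section

open Complex Filter Topology Set MeasureTheory Real intervalIntegral
open scoped Real Interval

namespace Literature.NumberTheory.LFunctions.Zhang2022.Lemma84

open Literature.NumberTheory.LFunctions Literature.Analysis.Complex Literature.Analysis.SpecialFunctions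

/-! ### The integrand on a vertical line -/

section Line

variable {Φ : ℂ → ℂ} {L : ℝ}

/-- `‖e^{(σ+it)L}‖ = e^{σL}`. [folklore] -/
private theorem norm_cexp_line (σ t L : ℝ) : ‖cexp (((σ : ℂ) + t * I) * (L : ℂ))‖ = Real.exp (σ * L) := by
  rw [Complex.norm_exp]
  congr 1
  simp [Complex.mul_re]

/-- **Pointwise bound on a vertical line**: if `‖Φ(σ+it)‖ ≤ M` then
`‖e^{(σ+it)L}Φ(σ+it)/(σ+it)²‖ ≤ e^{σL}M/(σ²+t²)`. [cite: MontgomeryVaughan2007, §6.2] -/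
theorem norm_G_line_le {σ M : ℝ} {t : ℝ} (hΦ : ‖Φ ((σ : ℂ) + t * I)‖ ≤ M) (hσt : σ ^ 2 + t ^ 2 ≠ 0) :
    ‖cexp (((σ : ℂ) + t * I) * (L : ℂ)) * Φ ((σ : ℂ) + t * I) / ((σ : ℂ) + t * I) ^ 2‖ ≤
      Real.exp (σ * L) * M / (σ ^ 2 + t ^ 2) := by
  have hnsq : ‖((σ : ℂ) + t * I)‖ ^ 2 = σ ^ 2 + t ^ 2 := by
    rw [Complex.sq_norm, Complex.normSq_apply]; simp; ring
  have hpos : 0 < σ ^ 2 + t ^ 2 := lt_of_le_of_ne (by positivity) (Ne.symm hσt)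
  rw [norm_div, norm_mul, norm_pow, hnsq, norm_cexp_line, div_le_div_iff_of_pos_right hpos]
  exact mul_le_mul_of_nonneg_left hΦ (Real.exp_pos _).le

/-- **Integrability on a vertical line `Re u = σ ≠ 0`**: if `Φ` is continuous on the line and
`‖Φ(σ+it)‖ ≤ M` there, then `t ↦ e^{(σ+it)L}Φ(σ+it)/(σ+it)²` is integrable.
[cite: MontgomeryVaughan2007, §5.1 (5.22)] -/
theorem integrable_line {σ M : ℝ} (hσ : 0 < σ)
    (hcont : Continuous fun t : ℝ => Φ ((σ : ℂ) + t * I)) (hΦ : ∀ t : ℝ, ‖Φ ((σ : ℂ) + t * I)‖ ≤ M) :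
    Integrable fun t : ℝ =>
      cexp (((σ : ℂ) + t * I) * (L : ℂ)) * Φ ((σ : ℂ) + t * I) / ((σ : ℂ) + t * I) ^ 2 := by
  have hne : ∀ t : ℝ, (σ : ℂ) + t * I ≠ 0 := LogRieszMean.line_ne_zero hσ
  have hc : Continuous fun t : ℝ =>
      cexp (((σ : ℂ) + t * I) * (L : ℂ)) * Φ ((σ : ℂ) + t * I) / ((σ : ℂ) + t * I) ^ 2 := by
    refine Continuous.div (Continuous.mul ?_ hcont) (by fun_prop) fun t => pow_ne_zero 2 (hne t)
    fun_prop
  refine (((integrable_inv_sq_add_sq_of_ne_zero hσ.ne').const_mul (Real.exp (σ * L) * M)).mono'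
    hc.aestronglyMeasurable (Eventually.of_forall fun t => ?_))
  have hσt : σ ^ 2 + t ^ 2 ≠ 0 := by positivity
  calc _ ≤ Real.exp (σ * L) * M / (σ ^ 2 + t ^ 2) := norm_G_line_le (hΦ t) hσt
    _ = Real.exp (σ * L) * M * (σ ^ 2 + t ^ 2)⁻¹ := by rw [div_eq_mul_inv]

end Line

/-! ### Perron at `Re u = κ` and the pole-free shift to `Re u = σ₀` -/

/-- **Perron's formula (8.9), shifted to `Re u = σ₀`**: let `∑ f(n)n^{-u}` converge absolutely at
`u = κ`, let `Φ` be complex differentiable on the closed strip `σ₀ ≤ Re u ≤ κ` (`0 < σ₀ ≤ κ`) with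
`‖Φ‖ ≤ M` there and `L(f, κ+it) = Φ(κ+it)`. Then for `x ≥ 1`,
`∑_{n≤x} f(n)log(x/n) = (1/2π)∫ e^{(σ₀+it)log x}Φ(σ₀+it)(σ₀+it)⁻² dt` (the tree's Perron formula for
logarithmic Riesz means, then Cauchy's theorem on `[σ₀, κ] × [−T, T]`, `T → ∞`).
[cite: Zhang2022LandauSiegel, §8 (8.9)] [cite: MontgomeryVaughan2007, §5.1 (5.21)–(5.22)] -/
theorem sum_log_eq_integral_shift {f : ℕ → ℂ} {x : ℝ} (hx : 1 ≤ x) {σ₀ κ : ℝ} (hσ₀ : 0 < σ₀)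
    (hσκ : σ₀ ≤ κ) (hsum : LSeriesSummable f κ) {Φ : ℂ → ℂ}
    (hΦd : DifferentiableOn ℂ Φ (re ⁻¹' Icc σ₀ κ))
    (hΦeq : ∀ t : ℝ, LSeries f ((κ : ℂ) + t * I) = Φ ((κ : ℂ) + t * I)) {M : ℝ}
    (hM : ∀ u : ℂ, σ₀ ≤ u.re → u.re ≤ κ → ‖Φ u‖ ≤ M) :
    ∑ n ∈ Finset.Ioc 0 ⌊x⌋₊, f n * (Real.log (x / n) : ℂ) =
      (1 / (2 * π) : ℂ) * ∫ t : ℝ, cexp (((σ₀ : ℂ) + t * I) * (Real.log x : ℂ)) *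
        Φ ((σ₀ : ℂ) + t * I) / ((σ₀ : ℂ) + t * I) ^ 2 := by
  have hx0 : 0 < x := by linarith
  have hκ0 : 0 < κ := lt_of_lt_of_le hσ₀ hσκ
  set Lx : ℝ := Real.log x with hLx
  have hLx0 : 0 ≤ Lx := Real.log_nonneg hx
  set G : ℂ → ℂ := fun u => cexp (u * (Lx : ℂ)) * Φ u / u ^ 2 with hG
  -- Perron at `κ`
  have hP := LogRieszMean.sum_mul_log_eq_integral_LSeries f hx0 hκ0 hsum
  have hcpow : ∀ u : ℂ, (x : ℂ) ^ u = cexp (u * (Lx : ℂ)) := fun u => by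
    rw [Complex.cpow_def_of_ne_zero (by exact_mod_cast hx0.ne'), ← Complex.ofReal_log hx0.le, hLx,
      mul_comm]
  have hPG : (∫ t : ℝ, (x : ℂ) ^ ((κ : ℂ) + t * I) * LSeries f (κ + t * I) *
      (1 / ((κ : ℂ) + t * I) ^ 2)) = ∫ t : ℝ, G ((κ : ℂ) + t * I) := by
    refine integral_congr_ae (Eventually.of_forall fun t => ?_)
    simp only [hG, hcpow, hΦeq t]
    ring
  rw [hP, hPG]
  -- continuity of `Φ` on lines inside the strip
  have hcontΦ : ∀ σ : ℝ, σ₀ ≤ σ → σ ≤ κ → Continuous fun t : ℝ => Φ ((σ : ℂ) + t * I) := by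
    intro σ h1 h2
    have hline : Continuous fun t : ℝ => (σ : ℂ) + t * I := by fun_prop
    refine hΦd.continuousOn.comp_continuous hline fun t => ?_
    simp only [mem_preimage, add_re, ofReal_re, mul_re, I_re, mul_zero, ofReal_im, I_im, mul_one,
      sub_self, add_zero, mem_Icc]
    exact ⟨h1, h2⟩
  have hMline : ∀ σ : ℝ, σ₀ ≤ σ → σ ≤ κ → ∀ t : ℝ, ‖Φ ((σ : ℂ) + t * I)‖ ≤ M := by
    intro σ h1 h2 t
    exact hM _ (by simp [h1]) (by simp [h2])
  have hintσ₀ : Integrable fun t : ℝ => G ((σ₀ : ℂ) + t * I) :=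
    integrable_line (L := Lx) hσ₀ (hcontΦ σ₀ le_rfl hσκ) (hMline σ₀ le_rfl hσκ)
  have hintκ : Integrable fun t : ℝ => G ((κ : ℂ) + t * I) :=
    integrable_line (L := Lx) hκ0 (hcontΦ κ hσκ le_rfl) (hMline κ hσκ le_rfl)
  -- differentiability of `G` on the closed strip
  have hGd : DifferentiableOn ℂ G (re ⁻¹' Icc σ₀ κ) := by
    intro u hu
    have hu' : σ₀ ≤ u.re ∧ u.re ≤ κ := hu
    have hu0 : u ≠ 0 := by
      intro h; rw [h] at hu'; simp at hu'; linarith [hu'.1]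
    have h1 : DifferentiableWithinAt ℂ (fun u : ℂ => cexp (u * (Lx : ℂ))) (re ⁻¹' Icc σ₀ κ) u :=
      ((differentiableAt_id.mul_const _).cexp).differentiableWithinAt
    exact (h1.mul (hΦd u hu)).div (differentiableWithinAt_id.pow 2) (pow_ne_zero 2 hu0)
  -- decay on horizontal segments
  have hdecay : ∀ ε : ℝ, 0 < ε → ∃ T₀ : ℝ, ∀ T : ℝ, T₀ ≤ |T| → ∀ u ∈ Icc σ₀ κ,
      ‖G (u + T * I)‖ ≤ ε := by
    intro ε hε
    have hM0 : 0 ≤ M := le_trans (norm_nonneg _) (hM (κ : ℂ) (by simp [hσκ]) (by simp))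
    set B : ℝ := Real.exp (κ * Lx) * M with hB
    have hB0 : 0 ≤ B := by positivity
    refine ⟨B / ε + 1, fun T hT u hu => ?_⟩
    have hBε : 0 ≤ B / ε := by positivity
    have hT1 : 1 ≤ |T| := by linarith
    have hT0 : 0 < |T| := by linarith
    have hTsq : B / ε < T ^ 2 := by
      have h1 : |T| ≤ T ^ 2 := by rw [← sq_abs]; nlinarith
      linarith
    have hT2 : 0 < T ^ 2 := lt_of_le_of_lt hBε hTsq
    have hut : u ^ 2 + T ^ 2 ≠ 0 := by nlinarith [sq_nonneg u]
    have hb := norm_G_line_le (L := Lx) (σ := u) (t := T) (hM _ (by simp [hu.1]) (by simp [hu.2])) hut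
    refine hb.trans ?_
    have hexp : Real.exp (u * Lx) ≤ Real.exp (κ * Lx) :=
      Real.exp_le_exp.2 (mul_le_mul_of_nonneg_right hu.2 hLx0)
    calc Real.exp (u * Lx) * M / (u ^ 2 + T ^ 2) ≤ B / T ^ 2 := by
          rw [hB]
          exact div_le_div₀ hB0 (mul_le_mul_of_nonneg_right hexp hM0) hT2 (by nlinarith [sq_nonneg u])
      _ ≤ ε := by
          rw [div_le_iff₀ hT2]
          have := (div_lt_iff₀ hε).1 hTsq
          linarith
  have hshift := integral_vertical_eq_of_differentiableOn hσκ hGd hintσ₀ hintκ hdecay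
  rw [← hshift]

/-! ### The rectangle decomposition of the shifted line -/

/-- **Truncating the line `Re u = σ₀` at height `T` against the rectangle `[−σ₁, σ₀]×[−T, T]`**:
for `Θ` integrable on the line,
`∫_ℝ Θ(σ₀+it)dt = ∫_{t≤−T} + ∫_{t>T} + ∫_{−T}^{T} Θ(−σ₁+it)dt + i∫_{−σ₁}^{σ₀}Θ(u−iT)du − i∫_{−σ₁}^{σ₀}Θ(u+iT)du − i∮_{∂R} Θ`
in the four-term convention `∮_{∂R} = bottom − top + i·right − i·left` of the tree (an identity of
integrals; the residues enter only through `∮_{∂R}`). [cite: Zhang2022LandauSiegel, §8 Lemma 8.4 (proof)]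
[cite: MontgomeryVaughan2007, §6.2] -/
theorem integral_line_decomp {Θ : ℂ → ℂ} {σ₀ σ₁ T : ℝ}
    (hint : Integrable fun t : ℝ => Θ ((σ₀ : ℂ) + t * I)) :
    ∫ t : ℝ, Θ ((σ₀ : ℂ) + t * I) =
      (∫ t in Iic (-T), Θ ((σ₀ : ℂ) + t * I)) + (∫ t in Ioi T, Θ ((σ₀ : ℂ) + t * I)) +
      (∫ t in (-T)..T, Θ (((-σ₁ : ℝ) : ℂ) + t * I)) +
      I * (∫ u in (-σ₁)..σ₀, Θ (u + ((-T : ℝ) : ℂ) * I)) -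
      I * (∫ u in (-σ₁)..σ₀, Θ (u + (T : ℂ) * I)) -
      I * rectBoundaryIntegral Θ (-σ₁) σ₀ (-T) T := by
  have hsplit1 := intervalIntegral.integral_Iic_add_Ioi (b := -T) hint.integrableOn hint.integrableOn
  have hsplit2 := intervalIntegral.integral_interval_add_Ioi (a := -T) (b := T) hint.integrableOn
    hint.integrableOn
  rw [← hsplit1, ← hsplit2, rectBoundaryIntegral_def]
  have hI : I * I = -1 := I_mul_I
  linear_combination ((∫ y : ℝ in (-T)..T, Θ ((σ₀ : ℂ) + ↑y * I)) -
    ∫ y : ℝ in (-T)..T, Θ (((-σ₁ : ℝ) : ℂ) + ↑y * I)) * hI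

/-! ### Bounds for the pieces -/

section Pieces

variable {Φ : ℂ → ℂ} {L : ℝ}

/-- **The two tails** on `Re u = σ₀ > 0`: if `‖Φ(σ₀+it)‖ ≤ M` for `|t| ≥ T ≥ 1` then
`‖∫_{t>T} G‖ + ‖∫_{t≤−T} G‖ ≤ 2e^{σ₀L}M/T` (`G = e^{uL}Φ(u)/u²`; `∫_T^∞ dt/t² = 1/T`).
[cite: MontgomeryVaughan2007, §6.2] -/
theorem norm_tails_le {σ₀ M T : ℝ} (hσ₀ : 0 < σ₀) (hT : 1 ≤ T) (hM : 0 ≤ M)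
    (hΦ : ∀ t : ℝ, T ≤ |t| → ‖Φ ((σ₀ : ℂ) + t * I)‖ ≤ M) :
    ‖∫ t in Ioi T, cexp (((σ₀ : ℂ) + t * I) * (L : ℂ)) * Φ ((σ₀ : ℂ) + t * I) / ((σ₀ : ℂ) + t * I) ^ 2‖
      + ‖∫ t in Iic (-T), cexp (((σ₀ : ℂ) + t * I) * (L : ℂ)) * Φ ((σ₀ : ℂ) + t * I) /
          ((σ₀ : ℂ) + t * I) ^ 2‖ ≤ 2 * (Real.exp (σ₀ * L) * M / T) := by
  have hT0 : 0 < T := by linarith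
  set g : ℝ → ℝ := fun t => Real.exp (σ₀ * L) * M * t ^ (-(2 : ℝ)) with hg
  have hgi : IntegrableOn g (Ioi T) :=
    (integrableOn_Ioi_rpow_of_lt (by norm_num : (-(2 : ℝ)) < -1) hT0).const_mul _
  have hgint : ∫ t in Ioi T, g t = Real.exp (σ₀ * L) * M / T := by
    rw [hg, MeasureTheory.integral_const_mul, integral_Ioi_rpow_of_lt (by norm_num) hT0]
    have : (-(2 : ℝ)) + 1 = -1 := by norm_num
    rw [this, Real.rpow_neg_one]
    field_simp
  -- pointwise bound for `|t| ≥ T`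
  have hpt : ∀ t : ℝ, T ≤ |t| →
      ‖cexp (((σ₀ : ℂ) + t * I) * (L : ℂ)) * Φ ((σ₀ : ℂ) + t * I) / ((σ₀ : ℂ) + t * I) ^ 2‖ ≤
        Real.exp (σ₀ * L) * M * |t| ^ (-(2 : ℝ)) := by
    intro t ht
    have ht0 : 0 < |t| := lt_of_lt_of_le hT0 ht
    have hσt : σ₀ ^ 2 + t ^ 2 ≠ 0 := by positivity
    refine (norm_G_line_le (hΦ t ht) hσt).trans ?_
    have h2 : |t| ^ (-(2 : ℝ)) = 1 / t ^ 2 := by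
      rw [Real.rpow_neg (abs_nonneg t), show (2 : ℝ) = ((2 : ℕ) : ℝ) by norm_num,
        Real.rpow_natCast, sq_abs, one_div]
    rw [h2, mul_one_div]
    have ht2 : 0 < t ^ 2 := by rw [← sq_abs]; positivity
    exact div_le_div_of_nonneg_left (by positivity) ht2 (by nlinarith)
  -- upper tail
  have hup : ‖∫ t in Ioi T, cexp (((σ₀ : ℂ) + t * I) * (L : ℂ)) * Φ ((σ₀ : ℂ) + t * I) /
      ((σ₀ : ℂ) + t * I) ^ 2‖ ≤ Real.exp (σ₀ * L) * M / T := by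
    have hbound : ∀ᵐ t : ℝ ∂(volume.restrict (Ioi T)),
        ‖cexp (((σ₀ : ℂ) + t * I) * (L : ℂ)) * Φ ((σ₀ : ℂ) + t * I) / ((σ₀ : ℂ) + t * I) ^ 2‖ ≤
          g t := by
      refine (ae_restrict_iff' measurableSet_Ioi).2 (Eventually.of_forall fun t (ht : T < t) => ?_)
      have := hpt t (by rw [abs_of_pos (hT0.trans ht)]; exact ht.le)
      rwa [abs_of_pos (hT0.trans ht)] at this
    exact (norm_integral_le_of_norm_le hgi hbound).trans hgint.le
  -- lower tail (reflect)
  have hlow : ‖∫ t in Iic (-T), cexp (((σ₀ : ℂ) + t * I) * (L : ℂ)) * Φ ((σ₀ : ℂ) + t * I) /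
      ((σ₀ : ℂ) + t * I) ^ 2‖ ≤ Real.exp (σ₀ * L) * M / T := by
    rw [← integral_comp_neg_Ioi]
    have hbound : ∀ᵐ t : ℝ ∂(volume.restrict (Ioi T)),
        ‖cexp (((σ₀ : ℂ) + ((-t : ℝ) : ℂ) * I) * (L : ℂ)) * Φ ((σ₀ : ℂ) + ((-t : ℝ) : ℂ) * I) /
          ((σ₀ : ℂ) + ((-t : ℝ) : ℂ) * I) ^ 2‖ ≤ g t := by
      refine (ae_restrict_iff' measurableSet_Ioi).2 (Eventually.of_forall fun t (ht : T < t) => ?_)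
      have := hpt (-t) (by rw [abs_neg, abs_of_pos (hT0.trans ht)]; exact ht.le)
      rwa [abs_neg, abs_of_pos (hT0.trans ht)] at this
    exact (norm_integral_le_of_norm_le hgi hbound).trans hgint.le
  linarith

/-- **The horizontal sides**: `‖∫_{−σ₁}^{σ₀} Θ(u + iT′)du‖ ≤ (σ₀ + σ₁)·B` if `‖Θ(u+iT′)‖ ≤ B` on the
segment (`−σ₁ ≤ σ₀`). [cite: MontgomeryVaughan2007, §6.2] -/
theorem norm_horizontal_le {Θ : ℂ → ℂ} {σ₀ σ₁ T' B : ℝ} (hσ : -σ₁ ≤ σ₀)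
    (hB : ∀ u : ℝ, -σ₁ ≤ u → u ≤ σ₀ → ‖Θ ((u : ℂ) + (T' : ℂ) * I)‖ ≤ B) :
    ‖∫ u in (-σ₁)..σ₀, Θ ((u : ℂ) + (T' : ℂ) * I)‖ ≤ (σ₀ + σ₁) * B := by
  have hb : ∀ u ∈ Ι (-σ₁) σ₀, ‖Θ ((u : ℂ) + (T' : ℂ) * I)‖ ≤ B := by
    intro u hu
    rw [uIoc_of_le hσ] at hu
    exact hB u hu.1.le hu.2
  have := intervalIntegral.norm_integral_le_of_norm_le_const hb
  rw [show σ₀ - -σ₁ = σ₀ + σ₁ by ring, abs_of_nonneg (by linarith : 0 ≤ σ₀ + σ₁)] at this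
  linarith

/-- **The left side** `Re u = −σ₁ < 0`: if `‖Φ(−σ₁+it)‖ ≤ M` for `|t| ≤ T` then
`‖∫_{−T}^{T} e^{(−σ₁+it)L}Φ(−σ₁+it)(−σ₁+it)⁻² dt‖ ≤ e^{−σ₁L}M·π/σ₁` (`∫_ℝ dt/(σ₁²+t²) = π/σ₁`).
[cite: MontgomeryVaughan2007, §6.2] -/
theorem norm_left_le {σ₁ M T : ℝ} (hσ₁ : 0 < σ₁) (hT : 0 ≤ T) (hM : 0 ≤ M)
    (hΦ : ∀ t : ℝ, |t| ≤ T → ‖Φ (((-σ₁ : ℝ) : ℂ) + t * I)‖ ≤ M) :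
    ‖∫ t in (-T)..T, cexp ((((-σ₁ : ℝ) : ℂ) + t * I) * (L : ℂ)) * Φ (((-σ₁ : ℝ) : ℂ) + t * I) /
        (((-σ₁ : ℝ) : ℂ) + t * I) ^ 2‖ ≤ Real.exp (-σ₁ * L) * M * (π / σ₁) := by
  set A : ℝ := Real.exp (-σ₁ * L) * M with hA
  have hA0 : 0 ≤ A := by positivity
  have hTT : -T ≤ T := by linarith
  set g : ℝ → ℝ := fun t => A * (σ₁ ^ 2 + t ^ 2)⁻¹ with hg
  have hgi : Integrable g := (integrable_inv_sq_add_sq_of_ne_zero hσ₁.ne').const_mul A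
  have hb : ∀ᵐ t : ℝ, t ∈ Ioc (-T) T →
      ‖cexp ((((-σ₁ : ℝ) : ℂ) + t * I) * (L : ℂ)) * Φ (((-σ₁ : ℝ) : ℂ) + t * I) /
        (((-σ₁ : ℝ) : ℂ) + t * I) ^ 2‖ ≤ g t := by
    refine Eventually.of_forall fun t ht => ?_
    have htT : |t| ≤ T := abs_le.2 ⟨ht.1.le, ht.2⟩
    have hσt : (-σ₁) ^ 2 + t ^ 2 ≠ 0 := by
      have : 0 < (-σ₁) ^ 2 := by rw [neg_sq]; positivity
      nlinarith [sq_nonneg t]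
    have h := norm_G_line_le (L := L) (σ := -σ₁) (hΦ t htT) hσt
    refine h.trans (le_of_eq ?_)
    rw [hg, hA, neg_sq, div_eq_mul_inv]
  have h1 := intervalIntegral.norm_integral_le_of_norm_le hTT hb (hgi.intervalIntegrable)
  refine h1.trans ?_
  rw [intervalIntegral.integral_of_le hTT]
  calc ∫ t in Ioc (-T) T, g t ≤ ∫ t, g t :=
        setIntegral_le_integral hgi (Eventually.of_forall fun t => by simp only [hg]; positivity)
    _ = A * (π / σ₁) := by
        rw [hg, MeasureTheory.integral_const_mul, integral_inv_sq_add_sq_eq_pi_div hσ₁]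

end Pieces

end Literature.NumberTheory.LFunctions.Zhang2022.Lemma84
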